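import Literature.MathematicalPhysics.QuantumFieldTheory.Balaban1983to89.B12Ward59

/-!
# Bałaban CMP 109 (1987) §5 END TO END for the limit tensor: from the invariant, gauge-invariant finite-volume
functional (5.1)/(5.2)/(4.15)₁ and the decay (5.10) to the representation (5.37)/(5.38) with β = (5.42) and the
remainder decay (5.44), and to the quadratic form (5.43) — the by-name composition closing the lineage's §5 chain

CITATION HEADER (lean-in-tree rule 2026-08-18).
* Source: T. Bałaban, "Renormalization group approach to lattice gauge field theories. I. Generation of effective
  actions in a small field approximation and a coupling constant renormalization in four dimensions", Commun. Math.
  Phys. **109** (1987) 249–301, doi:10.1007/bf01215223 [Balaban1987RG1] (cell paper B12; held: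
  `paper:balaban1987-cmp109-rg-i-small-field`; PDF page = journal page − 248), §5 pp. 292–298.  The sentences and
  displays quoted below were READ AS IMAGES by the author of this file on the 300-dpi renders of the audit cell
  (`HOME/b2b-balaban-ref1/pages/1987-cmp109-rg-I-small-field/…-p044-x2.png` = p. 292, `…-p045-x2.png` = p. 293,
  `…-p049-x2.png` = p. 297; HOME = the cell folder `run/shared/lean/pub/pub-balaban/`) and agree with the lineage
  transcript `HOME/b2b-balaban-b03/B12s-transcript.md`; inside quotation marks nothing is altered (outside them, as
  in `…B12Rep537`, Π̃ denotes the momentum-space function which print writes without a tilde).  Audit cell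
  `pub-balaban`, unit `b2b-balaban-b03-g20` (PAPER SUB-CELL B03 → B12 §§2–5 lineage, gen 20), node
  B12-REP538-LIMIT.  Imports only the lineage's own accepted module `…B12Ward59` (gen 19: (4.15)₁ ⇒ (5.9) at finite
  volume and in the limit; through it `…B12EuclCov567` (gen 18: (5.2) ⇒ (5.6)–(5.8) in the limit), `…B12Transl58`
  (gen 17: (5.8), the limit (5.1) as the hypothesis `hlim`), `…B12Covariance54`, `…B12Form543` (gen 9: (5.43)),
  `…B12Transverse536` (gen 6: (5.6), (5.7), (5.9)₁, (5.10) ⇒ (5.36)), `…B12Rep537` (gen 6: (5.36) + (5.10) ⇒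
  (5.37)/(5.38)/(5.42)/(5.44), after Gawędzki–Kupiainen [43] = `…GawedzkiKupiainen1985.PeriodicGleason`));
  modifies nothing; definition-free.
* Statements reproduced (verbatim).  p. 292 [PDF 44]: *"In the next section we will prove that the polarization
  tensor Π has a similar structure as the operator Δ_j, especially it has an expansion of the form (4.41), but with
  a coefficient. We define the β-function β_j(g_{j−1}) equal to this coefficient."*; (5.1) *"Π(b, b′) =
  lim_{T₁^{(j)}↗Z⁴} δ²/(δB(b)δB(b′)) 𝐄^{(j)}(U_j(exp iB))|_{B=0}. This representation is basic for the further
  analysis, because it implies symmetries of the tensor. The function 𝐄^{(j)}(U_j(exp iB)) is invariant with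
  respect to all Euclidean symmetries r of the lattice T₁^{(j)},"* (5.2) *"𝐄^{(j)}(U_j(exp irB)) =
  𝐄^{(j)}(rU_j(exp iB)) = 𝐄^{(j)}(U_j(exp iB)),"*.  p. 293 [PDF 45]: *"The function Π is also translation
  invariant and symmetric, hence"* (5.8) *"Π_{μν}(x, y) = Π_{μν}(x − y), Π_{μν}(x) = Π_{νμ}(−x). The gauge
  invariance, expressed in the first identity (4.15), implies"* (5.9) *"Σ_μ ∂*_μ Π_{μν}(x − y) = Σ_ν ∂_ν Π_{μν}(x −
  y) = 0. The representation (4.37) yields the following inequality"* (5.10) *"|Π_{μν}(x − y)| ≦ O(1)E₀ exp(−δ₁|x −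
  y|), with a positive constant δ₁ determined by δ₀, κ, and M"*; and, after (5.11)–(5.15), *"We will analyze this
  function using the above properties only. Our goal is to prove a representation of the form (4.41), more exactly
  of the form Π_{μν}(p) = β(δ_{μν}Δ(p) − \overline{∂_μ(p)}∂_ν(p)) + (terms of higher orders in derivatives ∂(p),
  \overline{∂(p)}), (5.16) and to find the coefficient β."*  p. 297 [PDF 49]: *"Using the relations (5.17) and
  substituting z_μ = e^{ip_μ}, we obtain finally"* (5.37) *"Π_{μν}(p) = β(δ_{μν}Δ(p) − \overline{∂_μ(p)}∂_ν(p)) +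
  Π′_{μν}(p). The function Π′_{μν}(p) has all the symmetries of the function Π_{μν}(p) and it can be written in the
  form of a third order polynomial in the derivatives \overline{∂(p)}, ∂(p),"* (5.38) *"… The coefficients Π′ can
  be extended to analytic functions of ζ = p + iq on the polystrip ×_μ{|q_μ| < δ₁}. It remains to calculate the
  coefficient β, i.e., to express it in terms of the tensor Π."*; (5.42) *"β = −(∂²/∂p₁∂p₂ Π₁₂)(0) =
  −(∂²/∂p_μ∂p_ν Π_{μν})(0) = Σ_x Π_{μν}(x)x_μx_ν for μ ≠ ν. This is the fundamental equality defining the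
  β-function. Let us finish now the analysis of the previous section. The first term on the right-hand side of
  (4.34), after all the changes and resummations, and using (5.37), (5.38), can be written as"* (5.43)
  *"Σ_{(x,μ),(y,ν)} Π_{μν}(x − y) tr δB_μ(x)B_ν(y) = β½Σ_{x,μ,ν} tr(∂δB)_{μν}(x)(∂B)_{μν}(x) + Σ_{(x,μ),(y,ν),κ,λ,ϱ}
  [Π′_{μν,κλϱ}(x − y) tr(∂_κ∂_λ∂_ϱδB_μ)(x)B_ν(y) + Π′_{μν,κ,λϱ}(x − y) tr(∂_λ∂_ϱδB_μ)(x)(∂_κB_ν)(y) + …]. The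
  analyticity properties mentioned after (5.38) imply the corresponding exponential decay properties of the
  functions in the above formula. More exactly, we have"* (5.44) *"|Π′_{μν,κλϱ}(x − y)| ≦ O(1)E₀ exp(½δ₁|x − y|)."*
  (sic: the minus sign in the exponent is missing in print — transcript note M-5.44; meant exp(−½δ₁|x − y|)).
* Proof route.  Print's §5 logic is: (5.1) + (5.2) ⇒ (5.4) ⇒ (5.6), (5.7); translation invariance and symmetry ⇒
  (5.8); (4.15)₁ ⇒ (5.9); (4.37) ⇒ (5.10); then *"using the above properties only"* (5.6)–(5.10) ⇒ (5.36) ⇒ (5.37),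
  (5.38), (5.42), (5.44) ⇒ (5.43).  Every arrow is an accepted module of this lineage; this file is their BY-NAME
  COMPOSITION into single statements whose hypotheses are exactly print's inputs — per volume `n` a `C²` function
  `f n` of the bond field `B : Fin d → Tn n → V` (print's `B ↦ 𝐄^{(j)}(U_j(exp iB))`) invariant under translations,
  axis permutations and single-axis reflections ((5.2) for the actions (5.3)) and satisfying the first
  Ward–Takahashi identity (4.15)₁, `Πv n` ITS Hessian kernel at `B = 0`, projections `π n : Z^d →+ Tn n`
  intertwining `permPt` / `twist` with torus maps, the pointwise limit (5.1) `hlim`, and for the one-variable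
  kernel `K_{μν}(z) = Π_{μν}(z, 0)` ONLY the decay (5.10) `B12Sec2to5.Decay510` — and whose conclusions are the
  lineage's typed (5.36) `B12Rep537.TaylorData3`, (5.37)/(5.38)/(5.44) (`B12Rep537.rep538`, `rep537_genFun`), the
  pair-independence behind (5.42)/(1.22) "for μ, ν arbitrary, μ ≠ ν", and (5.43) (`B12Form543.form`), with
  `β = B12Beta.secondMoment K μ₀ ν₀` = the right member of (5.42).  [folklore] composition; the cited displays are
  the loci of the composed statements.

WHY THIS NODE (the DAG edge it closes).  Gens 6–9 proved (5.36)–(5.38)/(5.42)–(5.44) for an abstract one-variable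
kernel `K` on `Z^d` from FOUR kernel hypotheses `PermCovariant K` (5.6), `ReflCovariant K` (5.7), `WardFirst K`
(5.9)₁, `Decay510` (5.10) (`…B12Transverse536.rep538_of_symmetries`, `…B12Form543.form543_of_symmetries`); gens
17–19 derived (5.8), (5.6)/(5.7) and (5.9) for `K = Π(·, 0)` of the LIMIT tensor (5.1) from the invariant,
gauge-invariant functional at finite volume (`…B12EuclCov567.symmetries_of_limit_of_invariance`,
`…B12Ward59.ward59_of_limit_of_gaugeInvariance`), but used them only toward (4.43)/(4.45)
(`moment2_eq_of_limit_of_gaugeInvariance`).  The representation theorems themselves were never stated for the limit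
tensor; this file does so (gen 19's OPEN item (b18)), so that the lineage now holds ONE kernel-checked statement of
print's §5 conclusion for print's §5 object with print's §5 inputs, (5.10) being the only hypothesis left on `K`.

DICTIONARY (paper ↦ Lean): as in `…B12Transl58` / `…B12EuclCov567` / `…B12Ward59` (finite volume: sites `Tn n`, bond
field `B : Fin d → Tn n → V`, Hessian kernel `hH`, translations `hftransl`, axis permutations `rn`, `hπr`, `hfperm`,
reflections `tn`, `hπt`, `hfrefl` with signs `rsgn`, (4.15)₁ `h415`, limit `hlim`) and `…B12Rep537` (coefficient
side: `wilsonQ μ ν` = the position kernel of `δ_{μν}Δ(p) − \overline{∂_μ(p)}∂_ν(p)`, `TaylorData3 β μ ν` = "(5.37)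
holds up to third-order terms", `rem538` = the coefficient kernels `Π′_{μν,κλϱ}` of (5.38), `deltaIter 3` = the
monomial `\overline{∂_κ}\overline{∂_λ}\overline{∂_ϱ}`, `genFun` = the symbol on the poly-annulus `PolyAnnulus d b` =
the closed sub-polystrip `|q_j| ≤ b < δ₁`; constants `K δ₁ d`, `MQ δ₁ d`, `Zd` explicit) and `…B12Form543` ((5.43):
`form`, `fsqB` = ½Σ tr(∂δB)(∂B), `spair`, `fdeltaIter`, finitely supported `a = δB`, `b = B`).

WHAT IS PROVED (kernel-checked, no `sorry`, standard axioms; the module is definition-free; every declaration is a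
`[folklore]` composition ABOUT the printed objects and carries the printed loci it assembles).
1. §1 (on `Z^d`, kernel level): `taylorData3_of_cov`, `rep538_of_cov` — two-variable (5.8)₁, (5.6), (5.7), the
   first-variable Ward identity and (5.10) for `K` ⇒ (5.36) and (5.37)/(5.38)/(5.44) for every component of `K`;
   `taylorData3_of_limit`, `rep538_of_limit` — the same from torus kernels `Πv n` (translation invariant, symmetric,
   `r_π`- and `ε`-covariant, first-variable Ward identity) and the limit (5.1) through intertwining projections.
2. §2 (from the functional, `𝕜 = ℝ`): `properties_of_limit_of_gaugeInvariance` — ALL of (5.6)–(5.9) for `K` (the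
   "above properties" of p. 293: (5.8)₁, (5.8)₂, `PermCovariant K`, `ReflCovariant K`, `WardFirst K`, (5.9)₂);
   `secondMoment_pair_indep_of_limit_of_gaugeInvariance` — `Σ_x K_{μν}(x)x_μx_ν` is the same number for all
   `μ ≠ ν` ((5.42)/(1.22) "for μ, ν arbitrary, μ ≠ ν"); `taylorData3_of_limit_of_gaugeInvariance` — (5.36) for every
   component, `β = B12Beta.secondMoment K μ₀ ν₀`; `rep538_of_limit_of_gaugeInvariance` — (5.37) + (5.38) with (5.44),
   coefficient form: `K_{μν}(x) − βQ_{μν}(x) = Σ_{(κ,λ,ϱ)}(Δ*_κΔ*_λΔ*_ϱ Π′_{μν,κλϱ})(x)`,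
   `|Π′_{μν,κλϱ}(x)| ≤ K(δ₁,d)³(C₁ + |β|MQ(δ₁,d))e^{−δ₁|x|₁}`; `rep537_genFun_of_limit_of_gaugeInvariance` — the
   printed multiplicative form (5.37)/(5.38) of the symbol on every closed sub-polystrip with the sup bounds behind
   (5.44); `form543_of_limit_of_gaugeInvariance` — (5.43) with (5.44) for `K`;
   `form543_twoVariable_of_limit_of_gaugeInvariance` — (5.43) with print's left member
   `Σ_{(x,μ),(y,ν)} Π_{μν}(x, y) δB_μ(x) B_ν(y)` written with the TWO-VARIABLE limit tensor ((5.8)₁ discharged too).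
   In all of §2 the only hypothesis on the limit object is (5.10) for `K` (`h510`, `0 < δ₁`) and `μ₀ ≠ ν₀`
   (`2 ≤ d` implicitly).

WHAT IS NOT PROVED HERE (and not claimed).  Everything upstream of the named hypotheses, exactly as in the parents:
that the actual functional `𝐄^{(j)}(U_j(exp iB))` is `C²` and invariant (5.2) and satisfies (4.15)₁ (i.e. (4.7)–(4.9),
(4.14)); the existence of the limit (5.1) and its identification with the series (4.37); (5.10) from (4.37)
(`…B12Transl58.decay510_tsum437` is the lineage's typed version, not invoked here); the identification of Taylor
coefficients of Π̃ at `p = 0` with monomial moments (standard; `…B12Rep537`); the colour structure `δ^{ab}`; `d = 4`;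
any statement about the sign or size of β (cell GAPS G-B12s-*).  The derivation (5.12)–(5.35) of (5.36) is NOT
used: (5.36) follows here on the coefficient side (`…B12Transverse536`, gen 6), which is a different but printed-
equivalent route ("using the above properties only").

HONEST FRAMING: value = one kernel-checked end-to-end statement of B12 §5 (inputs: invariant gauge-invariant
functional on the tori, the limit (5.1), the decay (5.10); outputs: (5.36)–(5.38), (5.42)–(5.44)) assembled by name
from the lineage's accepted modules; NOT a reproduction of any estimate of the paper, NOT summit progress (the host
summit — continuum Yang–Mills with mass gap — is untouched).
-/

namespace Literature.MathematicalPhysics.QuantumFieldTheory.Balaban1983to89.B12Rep538Limit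

open Literature.MathematicalPhysics.QuantumFieldTheory.GawedzkiKupiainen1985.PeriodicGleason (Pt unitVec l1 K
  deltaIter genFun PolyAnnulus Zd)
open Literature.MathematicalPhysics.QuantumFieldTheory.Balaban1983to89.B12Sec2to5 (Decay510)
open Literature.MathematicalPhysics.QuantumFieldTheory.Balaban1983to89.B12Rep537 (ofReal TaylorData3 wilsonQ rem538
  MQ expBound_of_decay510 rep538_of_decay510 rep537_genFun)
open Literature.MathematicalPhysics.QuantumFieldTheory.Balaban1983to89.B12Form543 (ofRealK form spair fdeltaIter
  FinSuppV form543_of_symmetries)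
open Literature.MathematicalPhysics.QuantumFieldTheory.Balaban1983to89.B12Pairing543Backward (fsqB)
open Literature.MathematicalPhysics.QuantumFieldTheory.Balaban1983to89.B12Transverse536 (WardFirst ReflCovariant
  rsgn taylorData3_of_symmetries rep538_of_symmetries)
open Literature.MathematicalPhysics.QuantumFieldTheory.Balaban1983to89.B12Covariance54 (permPt twist)
open Literature.MathematicalPhysics.QuantumFieldTheory.Balaban1983to89.B12EuclCov567 (permCovariant_kernel
  reflCovariant_kernel symmetries_of_limit symmetries_of_limit_of_invariance)
open Literature.MathematicalPhysics.QuantumFieldTheory.Balaban1983to89.B12Ward59 (sum_sub_fst_of_tendsto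
  wardFirst_of_twoVariable ward59_of_limit_of_gaugeInvariance eq59_of_limit_of_gaugeInvariance)
open Filter
open _root_.Topology

/-! ## §1 On `Z^d`, kernel level: two-variable (5.6)–(5.9)₁ + (5.10) ⇒ (5.36)–(5.38), (5.44) for `K = Π(·, 0)` -/

section Lattice

variable {d : ℕ} {P : Fin d → Fin d → Pt d → Pt d → ℝ} {C₁ δ₁ : ℝ} {μ₀ ν₀ : Fin d}

/-- **(5.36) for every component of `K = Π(·, 0)` from the TWO-VARIABLE symmetries**: translation invariance
(5.8)₁, the printed two-point laws (5.6) and (5.7), the first-variable Ward identity (5.9)₁ of `Π(x, y)`, and the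
decay (5.10) of `K` ⇒ the second-order Taylor data of `K_{μν}` are `β ×` those of `Q_{μν}`, `β = Σ_z K_{μ₀ν₀}(z)
z_{μ₀}z_{ν₀}` (`μ₀ ≠ ν₀`) — `…B12Transverse536.taylorData3_of_symmetries` with `PermCovariant`, `ReflCovariant`,
`WardFirst` discharged by `…B12EuclCov567.permCovariant_kernel`, `reflCovariant_kernel`,
`…B12Ward59.wardFirst_of_twoVariable`. [cite: Balaban1987RG1, (5.6) p.292, (5.7)-(5.10) p.293, (5.36) p.297, (5.42) p.297] -/
theorem taylorData3_of_cov (hT : ∀ μ ν a x y, P μ ν (x + a) (y + a) = P μ ν x y)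
    (hperm : ∀ (σ : Equiv.Perm (Fin d)) μ ν x y, P (σ μ) (σ ν) (permPt σ x) (permPt σ y) = P μ ν x y)
    (hrefl : ∀ ρ μ ν x y, P μ ν (twist ρ μ x) (twist ρ ν y) = rsgn ρ μ * rsgn ρ ν * P μ ν x y)
    (hW1 : ∀ ν x y, ∑ μ, (P μ ν (x - unitVec μ) y - P μ ν x y) = 0)
    (hδ : 0 < δ₁) (h510 : ∀ μ ν, Decay510 (fun z => P μ ν z 0) C₁ δ₁) (h0 : μ₀ ≠ ν₀) (μ ν : Fin d) :
    TaylorData3 ((B12Beta.secondMoment (fun μ ν z => P μ ν z 0) μ₀ ν₀ : ℝ) : ℂ) μ ν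
      (ofReal fun z => P μ ν z 0) :=
  taylorData3_of_symmetries (P := fun μ ν z => P μ ν z 0) hδ h510 (permCovariant_kernel hperm)
    (reflCovariant_kernel hT hrefl) (wardFirst_of_twoVariable hW1) h0 μ ν

/-- **(5.37) + (5.38) with (5.44) for every component of `K = Π(·, 0)` from the TWO-VARIABLE symmetries and (5.10)**,
coefficient form: `K_{μν}(x) − βQ_{μν}(x) = Σ_{(κ,λ,ϱ)}(Δ*_κΔ*_λΔ*_ϱ Π′_{μν,κλϱ})(x)` with
`|Π′_{μν,κλϱ}(x)| ≤ K(δ₁,d)³(C₁ + |β|MQ(δ₁,d))e^{−δ₁|x|₁}`, `β = Σ_z K_{μ₀ν₀}(z)z_{μ₀}z_{ν₀}`.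
[cite: Balaban1987RG1, (5.6) p.292, (5.7)-(5.10) p.293, (5.37)-(5.38), (5.42), (5.44) p.297] -/
theorem rep538_of_cov (hT : ∀ μ ν a x y, P μ ν (x + a) (y + a) = P μ ν x y)
    (hperm : ∀ (σ : Equiv.Perm (Fin d)) μ ν x y, P (σ μ) (σ ν) (permPt σ x) (permPt σ y) = P μ ν x y)
    (hrefl : ∀ ρ μ ν x y, P μ ν (twist ρ μ x) (twist ρ ν y) = rsgn ρ μ * rsgn ρ ν * P μ ν x y)
    (hW1 : ∀ ν x y, ∑ μ, (P μ ν (x - unitVec μ) y - P μ ν x y) = 0)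
    (hδ : 0 < δ₁) (h510 : ∀ μ ν, Decay510 (fun z => P μ ν z 0) C₁ δ₁) (h0 : μ₀ ≠ ν₀) (μ ν : Fin d) :
    (∀ x, ((P μ ν x 0 : ℝ) : ℂ) - ((B12Beta.secondMoment (fun μ ν z => P μ ν z 0) μ₀ ν₀ : ℝ) : ℂ) * wilsonQ μ ν x =
        ∑ μs : Fin 3 → Fin d, deltaIter 3 μs (rem538 (ofReal fun z => P μ ν z 0)
          ((B12Beta.secondMoment (fun μ ν z => P μ ν z 0) μ₀ ν₀ : ℝ) : ℂ) μ ν μs) x) ∧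
      ∀ (μs : Fin 3 → Fin d) (x : Pt d),
        ‖rem538 (ofReal fun z => P μ ν z 0) ((B12Beta.secondMoment (fun μ ν z => P μ ν z 0) μ₀ ν₀ : ℝ) : ℂ)
            μ ν μs x‖ ≤
          K δ₁ d ^ 3 * (C₁ + ‖((B12Beta.secondMoment (fun μ ν z => P μ ν z 0) μ₀ ν₀ : ℝ) : ℂ)‖ * MQ δ₁ d) *
            Real.exp (-δ₁ * l1 x) :=
  rep538_of_decay510 hδ (h510 μ ν) (taylorData3_of_cov hT hperm hrefl hW1 hδ h510 h0 μ ν)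

variable {ι : Type*} {l : Filter ι} [l.NeBot] {Tn : ι → Type*} [∀ n, AddCommGroup (Tn n)]

/-- **(5.36) for `K = Π(·, 0)` of the LIMIT tensor from torus kernels**: finite-volume translation invariance,
symmetry, `r_π`- and `ε`-covariance and the first-variable Ward identity of the kernels `Πv n` on the tori `Tn n`,
the pointwise limit (5.1) through projections `π n : Z^d →+ Tn n` intertwining `permPt` / `twist` with the torus
maps, and (5.10) for `K` ⇒ `TaylorData3 β μ ν K_{μν}` for all `μ ν`, `β = Σ_z K_{μ₀ν₀}(z)z_{μ₀}z_{ν₀}`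
(`…B12EuclCov567.symmetries_of_limit` + `…B12Ward59.sum_sub_fst_of_tendsto`).
[cite: Balaban1987RG1, (5.1)-(5.6) p.292, (5.7)-(5.10) p.293, (5.36), (5.42) p.297] -/
theorem taylorData3_of_limit (π : ∀ n, Pt d →+ Tn n) {Pv : ∀ n, Fin d → Fin d → Tn n → Tn n → ℝ}
    (hTv : ∀ n μ ν b x y, Pv n μ ν (x + b) (y + b) = Pv n μ ν x y)
    (hSv : ∀ n μ ν x y, Pv n μ ν x y = Pv n ν μ y x)
    (hlim : ∀ μ ν x y, Tendsto (fun n => Pv n μ ν (π n x) (π n y)) l (𝓝 (P μ ν x y)))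
    (rn : ∀ n, Equiv.Perm (Fin d) → Tn n → Tn n) (hπr : ∀ n σ x, π n (permPt σ x) = rn n σ (π n x))
    (hPermv : ∀ n (σ : Equiv.Perm (Fin d)) μ ν x y, Pv n (σ μ) (σ ν) (rn n σ x) (rn n σ y) = Pv n μ ν x y)
    (tn : ∀ n, Fin d → Fin d → Tn n → Tn n) (hπt : ∀ n ρ ν x, π n (twist ρ ν x) = tn n ρ ν (π n x))
    (hReflv : ∀ n ρ μ ν x y, Pv n μ ν (tn n ρ μ x) (tn n ρ ν y) = rsgn ρ μ * rsgn ρ ν * Pv n μ ν x y)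
    (hW1 : ∀ n ν x y, ∑ μ, (Pv n μ ν (x - π n (unitVec μ)) y - Pv n μ ν x y) = 0)
    (hδ : 0 < δ₁) (h510 : ∀ μ ν, Decay510 (fun z => P μ ν z 0) C₁ δ₁) (h0 : μ₀ ≠ ν₀) (μ ν : Fin d) :
    TaylorData3 ((B12Beta.secondMoment (fun μ ν z => P μ ν z 0) μ₀ ν₀ : ℝ) : ℂ) μ ν
      (ofReal fun z => P μ ν z 0) := by
  obtain ⟨-, -, hp, hr⟩ := symmetries_of_limit π hTv hSv hlim rn hπr hPermv tn hπt hReflv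
  exact taylorData3_of_symmetries (P := fun μ ν z => P μ ν z 0) hδ h510 hp hr
    (wardFirst_of_twoVariable
      (sum_sub_fst_of_tendsto (Pn := fun n μ ν x y => Pv n μ ν (π n x) (π n y)) (fun μ x => x - unitVec μ)
        (fun n ν x y => by simpa only [map_sub] using hW1 n ν (π n x) (π n y)) hlim)) h0 μ ν

/-- **(5.37) + (5.38) with (5.44) for `K = Π(·, 0)` of the LIMIT tensor from torus kernels** (hypotheses as in
`taylorData3_of_limit`), coefficient form with the explicit remainder bound.
[cite: Balaban1987RG1, (5.1)-(5.6) p.292, (5.7)-(5.10) p.293, (5.37)-(5.38), (5.42), (5.44) p.297] -/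
theorem rep538_of_limit (π : ∀ n, Pt d →+ Tn n) {Pv : ∀ n, Fin d → Fin d → Tn n → Tn n → ℝ}
    (hTv : ∀ n μ ν b x y, Pv n μ ν (x + b) (y + b) = Pv n μ ν x y)
    (hSv : ∀ n μ ν x y, Pv n μ ν x y = Pv n ν μ y x)
    (hlim : ∀ μ ν x y, Tendsto (fun n => Pv n μ ν (π n x) (π n y)) l (𝓝 (P μ ν x y)))
    (rn : ∀ n, Equiv.Perm (Fin d) → Tn n → Tn n) (hπr : ∀ n σ x, π n (permPt σ x) = rn n σ (π n x))
    (hPermv : ∀ n (σ : Equiv.Perm (Fin d)) μ ν x y, Pv n (σ μ) (σ ν) (rn n σ x) (rn n σ y) = Pv n μ ν x y)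
    (tn : ∀ n, Fin d → Fin d → Tn n → Tn n) (hπt : ∀ n ρ ν x, π n (twist ρ ν x) = tn n ρ ν (π n x))
    (hReflv : ∀ n ρ μ ν x y, Pv n μ ν (tn n ρ μ x) (tn n ρ ν y) = rsgn ρ μ * rsgn ρ ν * Pv n μ ν x y)
    (hW1 : ∀ n ν x y, ∑ μ, (Pv n μ ν (x - π n (unitVec μ)) y - Pv n μ ν x y) = 0)
    (hδ : 0 < δ₁) (h510 : ∀ μ ν, Decay510 (fun z => P μ ν z 0) C₁ δ₁) (h0 : μ₀ ≠ ν₀) (μ ν : Fin d) :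
    (∀ x, ((P μ ν x 0 : ℝ) : ℂ) - ((B12Beta.secondMoment (fun μ ν z => P μ ν z 0) μ₀ ν₀ : ℝ) : ℂ) * wilsonQ μ ν x =
        ∑ μs : Fin 3 → Fin d, deltaIter 3 μs (rem538 (ofReal fun z => P μ ν z 0)
          ((B12Beta.secondMoment (fun μ ν z => P μ ν z 0) μ₀ ν₀ : ℝ) : ℂ) μ ν μs) x) ∧
      ∀ (μs : Fin 3 → Fin d) (x : Pt d),
        ‖rem538 (ofReal fun z => P μ ν z 0) ((B12Beta.secondMoment (fun μ ν z => P μ ν z 0) μ₀ ν₀ : ℝ) : ℂ)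
            μ ν μs x‖ ≤
          K δ₁ d ^ 3 * (C₁ + ‖((B12Beta.secondMoment (fun μ ν z => P μ ν z 0) μ₀ ν₀ : ℝ) : ℂ)‖ * MQ δ₁ d) *
            Real.exp (-δ₁ * l1 x) :=
  rep538_of_decay510 hδ (h510 μ ν)
    (taylorData3_of_limit π hTv hSv hlim rn hπr hPermv tn hπt hReflv hW1 hδ h510 h0 μ ν)

end Lattice

/-! ## §2 From the functional: invariant, gauge-invariant `C²` functions on the tori + (5.1) + (5.10) ⇒ §5's output -/

section Functional

variable {d : ℕ} {V : Type*} [NormedAddCommGroup V] [NormedSpace ℝ V]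
  {P : Fin d → Fin d → Pt d → Pt d → ℝ} {ι : Type*} {l : Filter ι} [l.NeBot] {Tn : ι → Type*}
  [∀ n, AddCommGroup (Tn n)] [∀ n, Fintype (Tn n)] [∀ n, DecidableEq (Tn n)]

/-- **"The above properties" (5.6)–(5.9) of p. 293 for `K = Π(·, 0)` of the limit tensor, ALL from the functional**:
per volume a `C²` function `f n` of the bond field invariant under translations, axis permutations and single-axis
reflections ((5.2)/(5.3)) and satisfying (4.15)₁ (`h415`), `Πv n` its Hessian kernel at `0`, intertwining
projections and the pointwise limit (5.1) ⇒ (5.8)₁ `Π_{μν}(x, y) = K_{μν}(x − y)`, (5.8)₂ `K_{μν}(z) = K_{νμ}(−z)`,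
(5.6) `PermCovariant K`, (5.7) `ReflCovariant K`, (5.9)₁ `WardFirst K`, (5.9)₂ `Σ_ν (K_{μν}(z + e_ν) − K_{μν}(z)) = 0`
— `…B12EuclCov567.symmetries_of_limit_of_invariance` and `…B12Ward59.eq59_of_limit_of_gaugeInvariance` side by side.
[cite: Balaban1987RG1, (5.1)-(5.6) p.292, (5.7)-(5.9) p.293, (4.15) p.284] -/
theorem properties_of_limit_of_gaugeInvariance (π : ∀ n, Pt d →+ Tn n) {f : ∀ n, (Fin d → Tn n → V) → ℝ}
    (hf : ∀ n, ContDiff ℝ 2 (f n)) (v : V) {Pv : ∀ n, Fin d → Fin d → Tn n → Tn n → ℝ}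
    (hH : ∀ n μ ν x y, Pv n μ ν x y =
      fderiv ℝ (fderiv ℝ (f n)) 0 (Pi.single μ (Pi.single x v)) (Pi.single ν (Pi.single y v)))
    (hlim : ∀ μ ν x y, Tendsto (fun n => Pv n μ ν (π n x) (π n y)) l (𝓝 (P μ ν x y)))
    (hftransl : ∀ n (a : Tn n) (B : Fin d → Tn n → V), f n (fun μ y => B μ (y - a)) = f n B)
    (rn : ∀ n, Equiv.Perm (Fin d) → Tn n ≃ Tn n) (hπr : ∀ n σ x, π n (permPt σ x) = rn n σ (π n x))
    (hfperm : ∀ n (σ : Equiv.Perm (Fin d)) (B : Fin d → Tn n → V),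
      f n (fun ν y => B (σ.symm ν) ((rn n σ).symm y)) = f n B)
    (tn : ∀ n, Fin d → Fin d → Tn n ≃ Tn n) (hπt : ∀ n ρ ν x, π n (twist ρ ν x) = tn n ρ ν (π n x))
    (hfrefl : ∀ n ρ (B : Fin d → Tn n → V), f n (fun ν y => rsgn ρ ν • B ν (tn n ρ ν y)) = f n B)
    (h415 : ∀ n (u : Fin d → Tn n → V) (lam : Tn n → V),
      fderiv ℝ (fderiv ℝ (f n)) 0 u (fun ν y => lam (y + π n (unitVec ν)) - lam y) = 0) :
    (∀ μ ν x y, P μ ν x y = P μ ν (x - y) 0) ∧ (∀ μ ν z, P μ ν z 0 = P ν μ (-z) 0) ∧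
      B12Beta.PermCovariant (fun μ ν z => P μ ν z 0) ∧ ReflCovariant (fun μ ν z => P μ ν z 0) ∧
      WardFirst (fun μ ν z => P μ ν z 0) ∧ ∀ μ z, ∑ ν, (P μ ν (z + unitVec ν) 0 - P μ ν z 0) = 0 := by
  obtain ⟨hT, hS, hp, hr⟩ := symmetries_of_limit_of_invariance π hf v hH hlim hftransl rn hπr hfperm tn hπt hfrefl
  obtain ⟨hW, hW2, -, -⟩ := eq59_of_limit_of_gaugeInvariance π hf v hH hlim hftransl h415
  exact ⟨hT, hS, hp, hr, hW, hW2⟩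

/-- **"for μ, ν arbitrary, μ ≠ ν" in (5.42)/(1.22), for the limit tensor**: the second moment
`Σ_x K_{μν}(x)x_μx_ν` of `K = Π(·, 0)` is the same number for every pair `μ ≠ ν` — by (5.6) for the limit tensor
(`B12Beta.secondMoment_pair_indep`; no decay needed). [cite: Balaban1987RG1, (5.42) p.297, (1.22) p.264, (5.6) p.292] -/
theorem secondMoment_pair_indep_of_limit_of_gaugeInvariance (π : ∀ n, Pt d →+ Tn n)
    {f : ∀ n, (Fin d → Tn n → V) → ℝ} (hf : ∀ n, ContDiff ℝ 2 (f n)) (v : V)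
    {Pv : ∀ n, Fin d → Fin d → Tn n → Tn n → ℝ}
    (hH : ∀ n μ ν x y, Pv n μ ν x y =
      fderiv ℝ (fderiv ℝ (f n)) 0 (Pi.single μ (Pi.single x v)) (Pi.single ν (Pi.single y v)))
    (hlim : ∀ μ ν x y, Tendsto (fun n => Pv n μ ν (π n x) (π n y)) l (𝓝 (P μ ν x y)))
    (hftransl : ∀ n (a : Tn n) (B : Fin d → Tn n → V), f n (fun μ y => B μ (y - a)) = f n B)
    (rn : ∀ n, Equiv.Perm (Fin d) → Tn n ≃ Tn n) (hπr : ∀ n σ x, π n (permPt σ x) = rn n σ (π n x))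
    (hfperm : ∀ n (σ : Equiv.Perm (Fin d)) (B : Fin d → Tn n → V),
      f n (fun ν y => B (σ.symm ν) ((rn n σ).symm y)) = f n B)
    (tn : ∀ n, Fin d → Fin d → Tn n ≃ Tn n) (hπt : ∀ n ρ ν x, π n (twist ρ ν x) = tn n ρ ν (π n x))
    (hfrefl : ∀ n ρ (B : Fin d → Tn n → V), f n (fun ν y => rsgn ρ ν • B ν (tn n ρ ν y)) = f n B)
    {μ₀ ν₀ : Fin d} (h0 : μ₀ ≠ ν₀) {μ ν : Fin d} (hμν : μ ≠ ν) :
    B12Beta.secondMoment (fun μ ν z => P μ ν z 0) μ ν = B12Beta.secondMoment (fun μ ν z => P μ ν z 0) μ₀ ν₀ :=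
  B12Beta.secondMoment_pair_indep
    (symmetries_of_limit_of_invariance π hf v hH hlim hftransl rn hπr hfperm tn hπt hfrefl).2.2.1 h0 hμν

variable {C₁ δ₁ : ℝ} {μ₀ ν₀ : Fin d}

/-- **(5.36) FOR THE LIMIT TENSOR FROM THE FUNCTIONAL**: per volume a `C²` function `f n` of the bond field
`B : Fin d → Tn n → V` (print's `B ↦ 𝐄^{(j)}(U_j(exp iB))`) invariant under translations, axis permutations and
single-axis reflections ((5.2)/(5.3)) and satisfying the first Ward–Takahashi identity (4.15)₁ (`h415`), `Πv n`
its Hessian kernel at `B = 0`, projections intertwining `permPt` / `twist` with torus maps, the pointwise limit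
(5.1) (`hlim`), and for `K = Π(·, 0)` ONLY the decay (5.10) ⇒ for every component the second-order Taylor data of
`K_{μν}` are `β ×` those of `Q_{μν} = δ_{μν}Δ − \overline{∂_μ}∂_ν` («using the above properties only»), with
`β = Σ_x K_{μ₀ν₀}(x)x_{μ₀}x_{ν₀}` = (5.42).
[cite: Balaban1987RG1, (5.1)-(5.2) p.292, (5.8)-(5.10), (5.16) p.293, (5.36), (5.42) p.297, (4.15) p.284] -/
theorem taylorData3_of_limit_of_gaugeInvariance (π : ∀ n, Pt d →+ Tn n) {f : ∀ n, (Fin d → Tn n → V) → ℝ}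
    (hf : ∀ n, ContDiff ℝ 2 (f n)) (v : V) {Pv : ∀ n, Fin d → Fin d → Tn n → Tn n → ℝ}
    (hH : ∀ n μ ν x y, Pv n μ ν x y =
      fderiv ℝ (fderiv ℝ (f n)) 0 (Pi.single μ (Pi.single x v)) (Pi.single ν (Pi.single y v)))
    (hlim : ∀ μ ν x y, Tendsto (fun n => Pv n μ ν (π n x) (π n y)) l (𝓝 (P μ ν x y)))
    (hftransl : ∀ n (a : Tn n) (B : Fin d → Tn n → V), f n (fun μ y => B μ (y - a)) = f n B)
    (rn : ∀ n, Equiv.Perm (Fin d) → Tn n ≃ Tn n) (hπr : ∀ n σ x, π n (permPt σ x) = rn n σ (π n x))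
    (hfperm : ∀ n (σ : Equiv.Perm (Fin d)) (B : Fin d → Tn n → V),
      f n (fun ν y => B (σ.symm ν) ((rn n σ).symm y)) = f n B)
    (tn : ∀ n, Fin d → Fin d → Tn n ≃ Tn n) (hπt : ∀ n ρ ν x, π n (twist ρ ν x) = tn n ρ ν (π n x))
    (hfrefl : ∀ n ρ (B : Fin d → Tn n → V), f n (fun ν y => rsgn ρ ν • B ν (tn n ρ ν y)) = f n B)
    (h415 : ∀ n (u : Fin d → Tn n → V) (lam : Tn n → V),
      fderiv ℝ (fderiv ℝ (f n)) 0 u (fun ν y => lam (y + π n (unitVec ν)) - lam y) = 0)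
    (hδ : 0 < δ₁) (h510 : ∀ μ ν, Decay510 (fun z => P μ ν z 0) C₁ δ₁) (h0 : μ₀ ≠ ν₀) (μ ν : Fin d) :
    TaylorData3 ((B12Beta.secondMoment (fun μ ν z => P μ ν z 0) μ₀ ν₀ : ℝ) : ℂ) μ ν
      (ofReal fun z => P μ ν z 0) := by
  obtain ⟨-, -, hp, hr, hW, -⟩ :=
    properties_of_limit_of_gaugeInvariance π hf v hH hlim hftransl rn hπr hfperm tn hπt hfrefl h415
  exact taylorData3_of_symmetries (P := fun μ ν z => P μ ν z 0) hδ h510 hp hr hW h0 μ ν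

/-- **(5.37) + (5.38) WITH β = (5.42) AND THE REMAINDER DECAY (5.44) FOR THE LIMIT TENSOR FROM THE FUNCTIONAL**
(hypotheses as in `taylorData3_of_limit_of_gaugeInvariance`), coefficient form: for every component,
`K_{μν}(x) − βQ_{μν}(x) = Σ_{(κ,λ,ϱ)}(Δ*_κΔ*_λΔ*_ϱ Π′_{μν,κλϱ})(x)` («Π_{μν}(p) = β(δ_{μν}Δ(p) − \overline{∂_μ(p)}∂_ν(p)) +
Π′_{μν}(p)», Π′ «a third order polynomial in the derivatives») with `|Π′_{μν,κλϱ}(x)| ≤ K(δ₁,d)³(C₁ +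
|β|MQ(δ₁,d))e^{−δ₁|x|₁}` («|Π′_{μν,κλϱ}(x − y)| ≦ O(1)E₀ exp(½δ₁|x − y|)», sic), `β = Σ_x K_{μ₀ν₀}(x)x_{μ₀}x_{ν₀}`.
[cite: Balaban1987RG1, (5.1)-(5.2) p.292, (5.8)-(5.10) p.293, (5.37)-(5.38), (5.42), (5.44) p.297, (4.15) p.284] -/
theorem rep538_of_limit_of_gaugeInvariance (π : ∀ n, Pt d →+ Tn n) {f : ∀ n, (Fin d → Tn n → V) → ℝ}
    (hf : ∀ n, ContDiff ℝ 2 (f n)) (v : V) {Pv : ∀ n, Fin d → Fin d → Tn n → Tn n → ℝ}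
    (hH : ∀ n μ ν x y, Pv n μ ν x y =
      fderiv ℝ (fderiv ℝ (f n)) 0 (Pi.single μ (Pi.single x v)) (Pi.single ν (Pi.single y v)))
    (hlim : ∀ μ ν x y, Tendsto (fun n => Pv n μ ν (π n x) (π n y)) l (𝓝 (P μ ν x y)))
    (hftransl : ∀ n (a : Tn n) (B : Fin d → Tn n → V), f n (fun μ y => B μ (y - a)) = f n B)
    (rn : ∀ n, Equiv.Perm (Fin d) → Tn n ≃ Tn n) (hπr : ∀ n σ x, π n (permPt σ x) = rn n σ (π n x))
    (hfperm : ∀ n (σ : Equiv.Perm (Fin d)) (B : Fin d → Tn n → V),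
      f n (fun ν y => B (σ.symm ν) ((rn n σ).symm y)) = f n B)
    (tn : ∀ n, Fin d → Fin d → Tn n ≃ Tn n) (hπt : ∀ n ρ ν x, π n (twist ρ ν x) = tn n ρ ν (π n x))
    (hfrefl : ∀ n ρ (B : Fin d → Tn n → V), f n (fun ν y => rsgn ρ ν • B ν (tn n ρ ν y)) = f n B)
    (h415 : ∀ n (u : Fin d → Tn n → V) (lam : Tn n → V),
      fderiv ℝ (fderiv ℝ (f n)) 0 u (fun ν y => lam (y + π n (unitVec ν)) - lam y) = 0)
    (hδ : 0 < δ₁) (h510 : ∀ μ ν, Decay510 (fun z => P μ ν z 0) C₁ δ₁) (h0 : μ₀ ≠ ν₀) (μ ν : Fin d) :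
    (∀ x, ((P μ ν x 0 : ℝ) : ℂ) - ((B12Beta.secondMoment (fun μ ν z => P μ ν z 0) μ₀ ν₀ : ℝ) : ℂ) * wilsonQ μ ν x =
        ∑ μs : Fin 3 → Fin d, deltaIter 3 μs (rem538 (ofReal fun z => P μ ν z 0)
          ((B12Beta.secondMoment (fun μ ν z => P μ ν z 0) μ₀ ν₀ : ℝ) : ℂ) μ ν μs) x) ∧
      ∀ (μs : Fin 3 → Fin d) (x : Pt d),
        ‖rem538 (ofReal fun z => P μ ν z 0) ((B12Beta.secondMoment (fun μ ν z => P μ ν z 0) μ₀ ν₀ : ℝ) : ℂ)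
            μ ν μs x‖ ≤
          K δ₁ d ^ 3 * (C₁ + ‖((B12Beta.secondMoment (fun μ ν z => P μ ν z 0) μ₀ ν₀ : ℝ) : ℂ)‖ * MQ δ₁ d) *
            Real.exp (-δ₁ * l1 x) :=
  rep538_of_decay510 hδ (h510 μ ν)
    (taylorData3_of_limit_of_gaugeInvariance π hf v hH hlim hftransl rn hπr hfperm tn hπt hfrefl h415 hδ h510 h0
      μ ν)

/-- **(5.37)/(5.38), PRINTED MULTIPLICATIVE FORM, FOR THE LIMIT TENSOR FROM THE FUNCTIONAL**: on every closed
sub-polystrip `|q_j| ≤ b < δ₁` (the poly-annulus `e^{−b} ≤ |w_j| ≤ e^{b}` at `w = e^{−iζ}`) the symbol `Σ_x K_{μν}(x)wˣ`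
of every component is `β(δ_{μν}Σ_κ(w_κ − 1)(w_κ⁻¹ − 1) − (w_μ − 1)(w_ν⁻¹ − 1)) + Σ_{(κ,λ,ϱ)}(w_κ − 1)(w_λ − 1)(w_ϱ − 1)·
Π̃′_{μν,κλϱ}(w)`, each `Π̃′` an absolutely convergent Laurent series bounded there by `K(δ₁,d)³(C₁ + |β|MQ(δ₁,d))·
Z_d(δ₁ − b)` («The coefficients Π′ can be extended to analytic functions of ζ = p + iq on the polystrip»),
`β = Σ_x K_{μ₀ν₀}(x)x_{μ₀}x_{ν₀}` — `…B12Rep537.rep537_genFun` for the limit kernel.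
[cite: Balaban1987RG1, (5.1)-(5.2) p.292, (5.8)-(5.11) p.293, (5.37)-(5.38), (5.42) p.297, (4.15) p.284] -/
theorem rep537_genFun_of_limit_of_gaugeInvariance (π : ∀ n, Pt d →+ Tn n) {f : ∀ n, (Fin d → Tn n → V) → ℝ}
    (hf : ∀ n, ContDiff ℝ 2 (f n)) (v : V) {Pv : ∀ n, Fin d → Fin d → Tn n → Tn n → ℝ}
    (hH : ∀ n μ ν x y, Pv n μ ν x y =
      fderiv ℝ (fderiv ℝ (f n)) 0 (Pi.single μ (Pi.single x v)) (Pi.single ν (Pi.single y v)))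
    (hlim : ∀ μ ν x y, Tendsto (fun n => Pv n μ ν (π n x) (π n y)) l (𝓝 (P μ ν x y)))
    (hftransl : ∀ n (a : Tn n) (B : Fin d → Tn n → V), f n (fun μ y => B μ (y - a)) = f n B)
    (rn : ∀ n, Equiv.Perm (Fin d) → Tn n ≃ Tn n) (hπr : ∀ n σ x, π n (permPt σ x) = rn n σ (π n x))
    (hfperm : ∀ n (σ : Equiv.Perm (Fin d)) (B : Fin d → Tn n → V),
      f n (fun ν y => B (σ.symm ν) ((rn n σ).symm y)) = f n B)
    (tn : ∀ n, Fin d → Fin d → Tn n ≃ Tn n) (hπt : ∀ n ρ ν x, π n (twist ρ ν x) = tn n ρ ν (π n x))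
    (hfrefl : ∀ n ρ (B : Fin d → Tn n → V), f n (fun ν y => rsgn ρ ν • B ν (tn n ρ ν y)) = f n B)
    (h415 : ∀ n (u : Fin d → Tn n → V) (lam : Tn n → V),
      fderiv ℝ (fderiv ℝ (f n)) 0 u (fun ν y => lam (y + π n (unitVec ν)) - lam y) = 0)
    (hδ : 0 < δ₁) (h510 : ∀ μ ν, Decay510 (fun z => P μ ν z 0) C₁ δ₁) (h0 : μ₀ ≠ ν₀) {b : ℝ} (hb : b < δ₁)
    {w : Fin d → ℂ} (hw : w ∈ PolyAnnulus d b) (μ ν : Fin d) :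
    genFun (ofReal fun z => P μ ν z 0) w =
        ((B12Beta.secondMoment (fun μ ν z => P μ ν z 0) μ₀ ν₀ : ℝ) : ℂ) *
            ((if μ = ν then ∑ κ, (w κ - 1) * ((w κ)⁻¹ - 1) else 0) - (w μ - 1) * ((w ν)⁻¹ - 1)) +
          ∑ μs : Fin 3 → Fin d, (∏ j, (w (μs j) - 1)) *
            genFun (rem538 (ofReal fun z => P μ ν z 0)
              ((B12Beta.secondMoment (fun μ ν z => P μ ν z 0) μ₀ ν₀ : ℝ) : ℂ) μ ν μs) w ∧
      ∀ μs : Fin 3 → Fin d,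
        ‖genFun (rem538 (ofReal fun z => P μ ν z 0)
            ((B12Beta.secondMoment (fun μ ν z => P μ ν z 0) μ₀ ν₀ : ℝ) : ℂ) μ ν μs) w‖ ≤
          K δ₁ d ^ 3 * (C₁ + ‖((B12Beta.secondMoment (fun μ ν z => P μ ν z 0) μ₀ ν₀ : ℝ) : ℂ)‖ * MQ δ₁ d) *
            Zd (δ₁ - b) d :=
  rep537_genFun hδ (expBound_of_decay510 (h510 μ ν))
    (taylorData3_of_limit_of_gaugeInvariance π hf v hH hlim hftransl rn hπr hfperm tn hπt hfrefl h415 hδ h510 h0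
      μ ν) hb hw

/-- **(5.43) WITH (5.44) FOR THE LIMIT TENSOR FROM THE FUNCTIONAL** (hypotheses as in
`taylorData3_of_limit_of_gaugeInvariance`): for all finitely supported fields `a = δB`, `b = B`,
`Σ_{μν}Σ_{x,y} K_{μν}(x − y) a_μ(x) b_ν(y) = β·½Σ_xΣ_{μν}(curl a)_{μν}(x)(curl b)_{μν}(x)
+ Σ_{μν}Σ_{(κ,λ,ϱ)}Σ_{x,y} Π′_{μν,κλϱ}(x − y)(∂_κ∂_λ∂_ϱ a_μ)(x) b_ν(y)` («Σ Π_{μν}(x − y) tr δB_μ(x)B_ν(y) = β½Σ tr(∂δB)_{μν}(x)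
(∂B)_{μν}(x) + Σ[Π′_{μν,κλϱ}(x − y) tr(∂_κ∂_λ∂_ϱδB_μ)(x)B_ν(y) + …]»), `|Π′(z)| ≤ K(δ₁,d)³(C₁ + |β|MQ(δ₁,d))e^{−δ₁|z|₁}`,
`β = Σ_x K_{μ₀ν₀}(x)x_{μ₀}x_{ν₀}` — `…B12Form543.form543_of_symmetries` for the limit kernel.
[cite: Balaban1987RG1, (5.1)-(5.2) p.292, (5.8)-(5.10) p.293, (5.42)-(5.44) p.297, (4.15) p.284] -/
theorem form543_of_limit_of_gaugeInvariance (π : ∀ n, Pt d →+ Tn n) {f : ∀ n, (Fin d → Tn n → V) → ℝ}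
    (hf : ∀ n, ContDiff ℝ 2 (f n)) (v : V) {Pv : ∀ n, Fin d → Fin d → Tn n → Tn n → ℝ}
    (hH : ∀ n μ ν x y, Pv n μ ν x y =
      fderiv ℝ (fderiv ℝ (f n)) 0 (Pi.single μ (Pi.single x v)) (Pi.single ν (Pi.single y v)))
    (hlim : ∀ μ ν x y, Tendsto (fun n => Pv n μ ν (π n x) (π n y)) l (𝓝 (P μ ν x y)))
    (hftransl : ∀ n (a : Tn n) (B : Fin d → Tn n → V), f n (fun μ y => B μ (y - a)) = f n B)
    (rn : ∀ n, Equiv.Perm (Fin d) → Tn n ≃ Tn n) (hπr : ∀ n σ x, π n (permPt σ x) = rn n σ (π n x))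
    (hfperm : ∀ n (σ : Equiv.Perm (Fin d)) (B : Fin d → Tn n → V),
      f n (fun ν y => B (σ.symm ν) ((rn n σ).symm y)) = f n B)
    (tn : ∀ n, Fin d → Fin d → Tn n ≃ Tn n) (hπt : ∀ n ρ ν x, π n (twist ρ ν x) = tn n ρ ν (π n x))
    (hfrefl : ∀ n ρ (B : Fin d → Tn n → V), f n (fun ν y => rsgn ρ ν • B ν (tn n ρ ν y)) = f n B)
    (h415 : ∀ n (u : Fin d → Tn n → V) (lam : Tn n → V),
      fderiv ℝ (fderiv ℝ (f n)) 0 u (fun ν y => lam (y + π n (unitVec ν)) - lam y) = 0)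
    (hδ : 0 < δ₁) (h510 : ∀ μ ν, Decay510 (fun z => P μ ν z 0) C₁ δ₁) (h0 : μ₀ ≠ ν₀)
    {a b : Fin d → Pt d → ℂ} (ha : FinSuppV a) (hb : FinSuppV b) :
    form (ofRealK fun μ ν z => P μ ν z 0) a b =
        ((B12Beta.secondMoment (fun μ ν z => P μ ν z 0) μ₀ ν₀ : ℝ) : ℂ) * fsqB a b +
          ∑ μ, ∑ ν, ∑ μs : Fin 3 → Fin d,
            spair (rem538 (ofReal fun z => P μ ν z 0)
              ((B12Beta.secondMoment (fun μ ν z => P μ ν z 0) μ₀ ν₀ : ℝ) : ℂ) μ ν μs)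
              (fdeltaIter 3 μs (a μ)) (b ν) ∧
      ∀ (μ ν : Fin d) (μs : Fin 3 → Fin d) (z : Pt d),
        ‖rem538 (ofReal fun z => P μ ν z 0) ((B12Beta.secondMoment (fun μ ν z => P μ ν z 0) μ₀ ν₀ : ℝ) : ℂ)
            μ ν μs z‖ ≤
          K δ₁ d ^ 3 * (C₁ + ‖((B12Beta.secondMoment (fun μ ν z => P μ ν z 0) μ₀ ν₀ : ℝ) : ℂ)‖ * MQ δ₁ d) *
            Real.exp (-δ₁ * l1 z) := by
  obtain ⟨-, -, hp, hr, hW, -⟩ :=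
    properties_of_limit_of_gaugeInvariance π hf v hH hlim hftransl rn hπr hfperm tn hπt hfrefl h415
  exact form543_of_symmetries (P := fun μ ν z => P μ ν z 0) hδ h510 hp hr hW h0 ha hb

/-- **(5.43) WITH PRINT'S LEFT MEMBER WRITTEN WITH THE TWO-VARIABLE LIMIT TENSOR** `Π_{μν}(x, y)` of (5.1)
((5.8)₁ discharged as well): `Σ_{μν}Σ_{x,y} Π_{μν}(x, y) a_μ(x) b_ν(y) = β·fsqB a b + Σ_{μν}Σ_{(κ,λ,ϱ)}Σ_{x,y}
Π′_{μν,κλϱ}(x − y)(∂_κ∂_λ∂_ϱ a_μ)(x) b_ν(y)` with the bound (5.44) on `Π′` (hypotheses as in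
`taylorData3_of_limit_of_gaugeInvariance`). [cite: Balaban1987RG1, (5.1)-(5.2) p.292, (5.8)-(5.10) p.293, (5.42)-(5.44) p.297] -/
theorem form543_twoVariable_of_limit_of_gaugeInvariance (π : ∀ n, Pt d →+ Tn n)
    {f : ∀ n, (Fin d → Tn n → V) → ℝ} (hf : ∀ n, ContDiff ℝ 2 (f n)) (v : V)
    {Pv : ∀ n, Fin d → Fin d → Tn n → Tn n → ℝ}
    (hH : ∀ n μ ν x y, Pv n μ ν x y =
      fderiv ℝ (fderiv ℝ (f n)) 0 (Pi.single μ (Pi.single x v)) (Pi.single ν (Pi.single y v)))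
    (hlim : ∀ μ ν x y, Tendsto (fun n => Pv n μ ν (π n x) (π n y)) l (𝓝 (P μ ν x y)))
    (hftransl : ∀ n (a : Tn n) (B : Fin d → Tn n → V), f n (fun μ y => B μ (y - a)) = f n B)
    (rn : ∀ n, Equiv.Perm (Fin d) → Tn n ≃ Tn n) (hπr : ∀ n σ x, π n (permPt σ x) = rn n σ (π n x))
    (hfperm : ∀ n (σ : Equiv.Perm (Fin d)) (B : Fin d → Tn n → V),
      f n (fun ν y => B (σ.symm ν) ((rn n σ).symm y)) = f n B)
    (tn : ∀ n, Fin d → Fin d → Tn n ≃ Tn n) (hπt : ∀ n ρ ν x, π n (twist ρ ν x) = tn n ρ ν (π n x))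
    (hfrefl : ∀ n ρ (B : Fin d → Tn n → V), f n (fun ν y => rsgn ρ ν • B ν (tn n ρ ν y)) = f n B)
    (h415 : ∀ n (u : Fin d → Tn n → V) (lam : Tn n → V),
      fderiv ℝ (fderiv ℝ (f n)) 0 u (fun ν y => lam (y + π n (unitVec ν)) - lam y) = 0)
    (hδ : 0 < δ₁) (h510 : ∀ μ ν, Decay510 (fun z => P μ ν z 0) C₁ δ₁) (h0 : μ₀ ≠ ν₀)
    {a b : Fin d → Pt d → ℂ} (ha : FinSuppV a) (hb : FinSuppV b) :
    (∑ μ, ∑ ν, ∑' p : Pt d × Pt d, ((P μ ν p.1 p.2 : ℝ) : ℂ) * a μ p.1 * b ν p.2) =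
        ((B12Beta.secondMoment (fun μ ν z => P μ ν z 0) μ₀ ν₀ : ℝ) : ℂ) * fsqB a b +
          ∑ μ, ∑ ν, ∑ μs : Fin 3 → Fin d,
            spair (rem538 (ofReal fun z => P μ ν z 0)
              ((B12Beta.secondMoment (fun μ ν z => P μ ν z 0) μ₀ ν₀ : ℝ) : ℂ) μ ν μs)
              (fdeltaIter 3 μs (a μ)) (b ν) ∧
      ∀ (μ ν : Fin d) (μs : Fin 3 → Fin d) (z : Pt d),
        ‖rem538 (ofReal fun z => P μ ν z 0) ((B12Beta.secondMoment (fun μ ν z => P μ ν z 0) μ₀ ν₀ : ℝ) : ℂ)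
            μ ν μs z‖ ≤
          K δ₁ d ^ 3 * (C₁ + ‖((B12Beta.secondMoment (fun μ ν z => P μ ν z 0) μ₀ ν₀ : ℝ) : ℂ)‖ * MQ δ₁ d) *
            Real.exp (-δ₁ * l1 z) := by
  obtain ⟨hT, -, hp, hr, hW, -⟩ :=
    properties_of_limit_of_gaugeInvariance π hf v hH hlim hftransl rn hπr hfperm tn hπt hfrefl h415
  have e : (∑ μ, ∑ ν, ∑' p : Pt d × Pt d, ((P μ ν p.1 p.2 : ℝ) : ℂ) * a μ p.1 * b ν p.2) =
      form (ofRealK fun μ ν z => P μ ν z 0) a b := by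
    refine Finset.sum_congr rfl fun μ _ => Finset.sum_congr rfl fun ν _ => tsum_congr fun p => ?_
    rw [hT μ ν p.1 p.2]
    rfl
  rw [e]
  exact form543_of_symmetries (P := fun μ ν z => P μ ν z 0) hδ h510 hp hr hW h0 ha hb

end Functional

end Literature.MathematicalPhysics.QuantumFieldTheory.Balaban1983to89.B12Rep538Limit
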